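import Mathlib
import HarnessLib
import Literature.NumberTheory.LFunctions.RHWave0
import Literature.NumberTheory.LFunctions.LiouvilleSieve.Final

/-!
# RH family, wave 0 — proofs: the counterexample to Pólya's conjecture

Topic: `Literature/NumberTheory/LFunctions`. Sibling proof file of `RHWave0.lean`: it discharges
the named fact `Literature.NumberTheory.LFunctions.not_polya_conjecture` ("Pólya's conjecture `L(x) ≤ 0` for all `x ≥ 2` is
false", `L(x) = ∑_{n ≤ x} λ(n)` = `Literature.RH.liouvilleSum x`).

* `Literature.RH.liouvilleSum_tanakaWitness : liouvilleSum 906150257 = 1`;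
* `Literature.RH.not_polya_conjecture_holds : not_polya_conjecture`;
* `Literature.RH.polya_conjecture_first_failure_holds : polya_conjecture_first_failure` (Tanaka 1980:
  `906 150 257` is the least `n ≥ 2` with `L(n) > 0`; certified sieve of `LiouvilleSieve.lean`,
  blocks `LiouvilleSieve/Chunk*.lean`, chained in `LiouvilleSieve/Final.lean`).

## Sources

* C. B. Haselgrove, *A disproof of a conjecture of Pólya*, Mathematika **5** (1958) 141–145:
  the theorem itself (p. 143, "We are thus led to the conclusion that Pólya's conjecture is
  false"). Haselgrove's argument (Ingham's `A*_T(u)` with `T = 1000`, 649 zeros of `ζ`,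
  `A*_T(831.847) > 0`, whence `limsup L(x)/√x > 0`) is not constructive in `x`.
  [cite: HaselgroveMathematika1958, p. 143]
* M. Tanaka, *A numerical investigation on cumulative sum of the Liouville function*, Tokyo J.
  Math. **3** (1980) 187–189: the smallest counterexample is `x = 906 150 257`, where
  `L(x) = 1` (R. S. Lehman, 1960, had found `L(906 180 359) = 1`). This is the witness used
  here. [cite: Tanaka1980, main result]

## Method

The proof is the published computation, redone inside Lean: we evaluate `L(906150257) = 1`
exactly and conclude. `L` is evaluated by the classical recursion over the values `⌊x/k⌋`
coming from the Dirichlet-series identity `λ * ζ = 𝟙_{squares}`: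

1. *The identity* (`sum_Ioc_lsum_div`): for every `x : ℕ`,
   `∑_{1 ≤ m ≤ x} L(⌊x/m⌋) = ⌊√x⌋`. Proof: `∑_{n ≤ x} (ζ * λ)(n) = ∑_{m ≤ x} L(⌊x/m⌋)`
   (Mathlib's `ArithmeticFunction.sum_Ioc_mul_eq_sum_sum`), `(ζ * λ)(n) = ∑_{d ∣ n} λ(d)` is
   multiplicative with value `∑_{i ≤ k} (-1)^i = [k even]` at `p^k`, hence equals the indicator
   of the squares (`sum_divisors_liouville`), and there are `⌊√x⌋` squares in `[1, x]`.
   Consequently `L(v) = ⌊√v⌋ - ∑_{2 ≤ m ≤ v} L(⌊v/m⌋)` (`lsum_eq_sqrt_sub`), and on a block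
   `a < m ≤ ⌊v/⌊v/(a+1)⌋⌋` the quotient `⌊v/m⌋` is constant (`div_eq_of_mem_block`).
2. *A proof-carrying evaluator* (`PolyaCounterexample.certL`): table entries are triples
   `(v, z, z = L v)`, so every value read back from a table is certified by construction and no
   invariant about arrays is needed; the block loop `blockSum` returns
   `{z // z = acc + ∑_{a < m ≤ v} L(⌊v/m⌋)}`; small values `L(v)`, `v ≤ B`, are prefix sums of
   Mathlib's own (computable) `ArithmeticFunction.liouville`; a failed table lookup yields `none`
   (never a wrong value). `certEq N B z = true` therefore implies `L(N) = z`
   (`lsum_eq_of_certEq`) with no hypothesis on `B` or on the tables.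
3. *The evaluation* `certEq 906150257 100000 1 = true` is a closed boolean term; it is checked
   by `native_decide` (11 351 417 block steps for the `9061` large arguments `⌊N/k⌋` and
   3 935 804 trial divisions for the small table; ≈ 30 s in the interpreter). A kernel
   evaluation (`decide`) of the same term is out of reach by three to four orders of magnitude
   (kernel `Array`s are lists), and no sub-linear certificate for `L(x)` is known, so this
   discharge uses the axiom `Lean.ofReduceBool` (proposal flag `computational`), just as the
   printed proofs (Lehman 1960, Tanaka 1980) are machine computations. The value was
   cross-checked externally by two independent programs (a linear sieve of `Ω(n) mod 2` up to
   `9.065·10⁸`: `L(906150257) = 1` is the first `n ≥ 2` with `L(n) > 0`, `L(906316571) = 829`;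
   and the same recursion in C).

## Design notes

* Everything except the two final theorems lives in `Literature.RH.PolyaCounterexample`; `lsum n : ℤ`
  is `liouvilleSum` restricted to `ℕ` (`liouvilleSum_natCast`).
* The evaluator is total and structurally recursive (fuel = `v`), tail-recursive in its loops,
  and carries its correctness in subtypes; the only `cast` is along an equality of `ℤ`-valued
  targets in `blockSum` (to keep the recursive call in tail position).
-/

open Finset ArithmeticFunction

namespace Literature.NumberTheory.LFunctions

namespace PolyaCounterexample

/-! ### Blocks of constant quotient -/

/-- On the block `a < m ≤ ⌊v / ⌊v/(a+1)⌋⌋` the quotient `⌊v/m⌋` is constant, equal to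
`⌊v/(a+1)⌋` (the standard fact behind `O(√v)` enumeration of the values `⌊v/m⌋`). [folklore] -/
theorem div_eq_of_mem_block {v a m : ℕ} (hav : a < v) (ham : a < m)
    (hm : m ≤ v / (v / (a + 1))) : v / m = v / (a + 1) := by
  have hq : 0 < v / (a + 1) := Nat.div_pos (by omega) (by omega)
  have hm0 : 0 < m := by omega
  apply le_antisymm
  · exact Nat.div_le_div_left (by omega) (by omega)
  · rw [Nat.le_div_iff_mul_le hm0]
    rw [Nat.le_div_iff_mul_le hq] at hm
    rw [mul_comm]; exact hm

/-! ### The summatory Liouville function on `ℕ` and the identity `∑_{m ≤ x} L(x/m) = ⌊√x⌋` -/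

/-- `L(n) = ∑_{1 ≤ k ≤ n} λ(k)` for `n : ℕ` (this is `liouvilleSum n`, see
`liouvilleSum_natCast`). [folklore] -/
def lsum (n : ℕ) : ℤ := ∑ k ∈ Ioc 0 n, liouville k

/-- `L(n+1) = L(n) + λ(n+1)`. [folklore] -/
theorem lsum_succ (n : ℕ) : lsum (n + 1) = lsum n + liouville (n + 1) := by
  simp [lsum, sum_Ioc_succ_top (Nat.zero_le n)]

/-- `liouvilleSum` restricted to natural numbers is `lsum`. [folklore] -/
theorem _root_.Literature.NumberTheory.LFunctions.liouvilleSum_natCast (n : ℕ) : liouvilleSum (n : ℝ) = lsum n := by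
  simp [liouvilleSum, lsum, Nat.floor_natCast]

/-- `λ(p^k) = (-1)^k`. [folklore] -/
theorem liouville_apply_prime_pow {p : ℕ} (hp : p.Prime) (k : ℕ) :
    liouville (p ^ k) = (-1) ^ k := by
  rw [liouville_apply (pow_ne_zero k hp.ne_zero), cardFactors_apply_prime_pow hp]

/-- `∑_{i < n} (-1)^i = [n odd]` over `ℤ`, in the form used below:
`∑_{i ≤ k} (-1)^i = if k is even then 1 else 0`. [folklore] -/
theorem sum_range_succ_neg_one_pow (k : ℕ) :
    ∑ i ∈ range (k + 1), (-1 : ℤ) ^ i = if Even k then 1 else 0 := by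
  rw [neg_one_geom_sum]
  by_cases hk : Even k
  · simp [hk, Nat.even_add_one]
  · simp [hk, Nat.even_add_one]

/-- A natural number `n ≠ 0` is a square iff every exponent in its factorisation is even.
[folklore] -/
theorem isSquare_iff_even_factorization {n : ℕ} (hn : n ≠ 0) :
    IsSquare n ↔ ∀ p ∈ n.primeFactors, Even (n.factorization p) := by
  constructor
  · rintro ⟨r, rfl⟩ p _
    have hr : r ≠ 0 := by rintro rfl; simp at hn
    rw [Nat.factorization_mul hr hr]
    simp
  · intro h
    refine ⟨n.factorization.prod fun p k => p ^ (k / 2), ?_⟩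
    rw [← Finsupp.prod_mul]
    conv_lhs => rw [← Nat.prod_factorization_pow_eq_self hn]
    apply Finsupp.prod_congr
    intro p hp
    rw [← pow_add]
    congr 1
    have := h p (by simpa using hp)
    obtain ⟨t, ht⟩ := this
    omega

/-- `∑_{d ∣ n} λ(d) = [n is a square]` for `n ≠ 0` (i.e. `λ * ζ = 𝟙_{squares}`). [folklore] -/
theorem sum_divisors_liouville {n : ℕ} (hn : n ≠ 0) :
    ∑ d ∈ n.divisors, liouville d = if IsSquare n then 1 else 0 := by
  have hmul : IsMultiplicative ((zeta : ArithmeticFunction ℤ) * liouville) :=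
    isMultiplicative_zeta.natCast.mul isMultiplicative_liouville
  rw [← coe_zeta_mul_apply, hmul.multiplicative_factorization _ hn]
  have hpp : ∀ p ∈ n.primeFactors, ((zeta : ArithmeticFunction ℤ) * liouville) (p ^ n.factorization p)
      = if Even (n.factorization p) then 1 else 0 := by
    intro p hp
    have hp' : p.Prime := Nat.prime_of_mem_primeFactors hp
    rw [coe_zeta_mul_apply, Nat.sum_divisors_prime_pow hp']
    simp_rw [liouville_apply_prime_pow hp']
    exact sum_range_succ_neg_one_pow _
  rw [Finsupp.prod, Nat.support_factorization, prod_congr rfl hpp, prod_boole]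
  by_cases hsq : IsSquare n
  · rw [if_pos hsq, if_pos ((isSquare_iff_even_factorization hn).mp hsq)]
  · rw [if_neg hsq, if_neg (mt (isSquare_iff_even_factorization hn).mpr hsq)]

/-- There are `⌊√x⌋` squares in `[1, x]`. [folklore] -/
theorem card_filter_isSquare_Ioc (x : ℕ) :
    #{n ∈ Ioc 0 x | IsSquare n} = Nat.sqrt x := by
  have : {n ∈ Ioc 0 x | IsSquare n} = (Ioc 0 (Nat.sqrt x)).image fun m => m * m := by
    ext n
    simp only [mem_filter, mem_Ioc, mem_image]
    constructor
    · rintro ⟨⟨hn0, hnx⟩, r, rfl⟩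
      refine ⟨r, ⟨Nat.pos_of_ne_zero ?_, Nat.le_sqrt.mpr hnx⟩, rfl⟩
      rintro rfl; simp at hn0
    · rintro ⟨m, ⟨hm0, hmx⟩, rfl⟩
      exact ⟨⟨Nat.mul_pos hm0 hm0, Nat.le_sqrt.mp hmx⟩, m, rfl⟩
  rw [this, card_image_of_injective _ fun a b h => Nat.mul_self_inj.mp h, Nat.card_Ioc,
    Nat.sub_zero]

/-- **The identity.** `∑_{1 ≤ m ≤ x} L(⌊x/m⌋) = ⌊√x⌋` for every `x : ℕ`. [folklore] -/
theorem sum_Ioc_lsum_div (x : ℕ) : ∑ m ∈ Ioc 0 x, lsum (x / m) = Nat.sqrt x := by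
  have h1 : ∑ n ∈ Ioc 0 x, ((zeta : ArithmeticFunction ℤ) * liouville) n
      = ∑ m ∈ Ioc 0 x, lsum (x / m) := by
    rw [sum_Ioc_mul_eq_sum_sum]
    refine sum_congr rfl fun n hn => ?_
    rw [natCoe_apply, zeta_apply_ne (mem_Ioc.mp hn).1.ne', Nat.cast_one, one_mul]
    rfl
  have h2 : ∀ n ∈ Ioc 0 x, ((zeta : ArithmeticFunction ℤ) * liouville) n
      = if IsSquare n then 1 else 0 := fun n hn => by
    rw [coe_zeta_mul_apply, sum_divisors_liouville (mem_Ioc.mp hn).1.ne']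
  rw [← h1, sum_congr rfl h2, sum_boole, card_filter_isSquare_Ioc]

/-- **The recursion.** `L(v) = ⌊√v⌋ - ∑_{2 ≤ m ≤ v} L(⌊v/m⌋)` for `v ≥ 1`. [folklore] -/
theorem lsum_eq_sqrt_sub {v : ℕ} (hv : 0 < v) :
    lsum v = Nat.sqrt v - ∑ m ∈ Ioc 1 v, lsum (v / m) := by
  have := sum_Ioc_lsum_div v
  rw [← sum_Ioc_consecutive _ zero_le_one hv, show Ioc 0 1 = {1} by rfl, sum_singleton,
    Nat.div_one] at this
  omega

/-- One block of the recursion: for `a < v`, `q = ⌊v/(a+1)⌋`, `a' = ⌊v/q⌋`,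
`∑_{a < m ≤ v} L(⌊v/m⌋) = (a' - a) L(q) + ∑_{a' < m ≤ v} L(⌊v/m⌋)`. [folklore] -/
theorem blockSum_key {v a : ℕ} (hav : a < v) {z : ℤ} (hz : z = lsum (v / (a + 1))) (acc : ℤ) :
    acc + ((v / (v / (a + 1)) - a : ℕ) : ℤ) * z
        + ∑ m ∈ Ioc (v / (v / (a + 1))) v, lsum (v / m)
      = acc + ∑ m ∈ Ioc a v, lsum (v / m) := by
  have hq : 0 < v / (a + 1) := Nat.div_pos (by omega) (by omega)
  have ha' : a + 1 ≤ v / (v / (a + 1)) :=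
    (Nat.le_div_iff_mul_le hq).mpr (by rw [mul_comm]; exact Nat.div_mul_le_self v (a + 1))
  have ha'v : v / (v / (a + 1)) ≤ v := Nat.div_le_self _ _
  rw [← sum_Ioc_consecutive _ (by omega : a ≤ v / (v / (a + 1))) ha'v, hz]
  have hblock : ∀ m ∈ Ioc a (v / (v / (a + 1))), lsum (v / m) = lsum (v / (a + 1)) :=
    fun m hm => by rw [div_eq_of_mem_block hav (mem_Ioc.mp hm).1 (mem_Ioc.mp hm).2]
  rw [sum_congr rfl hblock, sum_const, Nat.card_Ioc, nsmul_eq_mul]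
  ring

/-! ### The proof-carrying evaluator -/

/-- A certified table entry: an argument `v`, a value `z`, and a proof that `z = L(v)`.
At run time this is just the pair `(v, z)`. [folklore] -/
structure Entry where
  /-- the argument -/
  v : ℕ
  /-- the value `L(v)` -/
  z : ℤ
  /-- the certificate -/
  hz : z = lsum v

/-- The entry `L(0) = 0`, also used as a placeholder (a placeholder is never *wrong*: lookups
compare the stored argument). [folklore] -/
def Entry.zero : Entry := ⟨0, 0, by simp [lsum]⟩

/-- Certified lookup of `L(q)`: arguments `q ≤ B` are read from `small[q]`, larger ones (of the
form `⌊N/k⌋`) from `large[K - ⌊N/q⌋]`; the stored argument is compared with `q`, so a hit is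
correct by construction and anything else is `none`. [folklore] -/
def lookup (N B K : ℕ) (small large : Array Entry) (q : ℕ) : Option {z : ℤ // z = lsum q} :=
  match (if q ≤ B then small[q]? else large[K - N / q]?) with
  | none => none
  | some e => if h : e.v = q then some ⟨e.z, h ▸ e.hz⟩ else none

/-- The block loop: returns `acc + ∑_{a < m ≤ v} L(⌊v/m⌋)`, consuming one block
`a < m ≤ ⌊v/⌊v/(a+1)⌋⌋` (on which `⌊v/m⌋ = ⌊v/(a+1)⌋`) per step; `fuel = v` suffices since `a`
increases. Tail-recursive; the `cast` is along `blockSum_key`. [folklore] -/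
def blockSum (look : (q : ℕ) → Option {z : ℤ // z = lsum q}) (v : ℕ) :
    (fuel a : ℕ) → (acc : ℤ) → Option {z : ℤ // z = acc + ∑ m ∈ Ioc a v, lsum (v / m)}
  | 0, a, acc =>
    if h : v ≤ a then some ⟨acc, by rw [Ioc_eq_empty (not_lt.mpr h), sum_empty, add_zero]⟩
    else none
  | fuel + 1, a, acc =>
    if h : v ≤ a then some ⟨acc, by rw [Ioc_eq_empty (not_lt.mpr h), sum_empty, add_zero]⟩
    else
      match look (v / (a + 1)) with
      | none => none
      | some ⟨z, hz⟩ =>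
        cast (congrArg (fun T : ℤ => Option {z : ℤ // z = T}) (blockSum_key (not_le.mp h) hz acc))
          (blockSum look v fuel (v / (v / (a + 1)))
            (acc + ((v / (v / (a + 1)) - a : ℕ) : ℤ) * z))

/-- One value of the recursion: `L(0) = 0`, `L(1) = 1`, and for `v ≥ 2`
`L(v) = ⌊√v⌋ - ∑_{2 ≤ m ≤ v} L(⌊v/m⌋)` with the sum taken from `blockSum`. [folklore] -/
def stepL (look : (q : ℕ) → Option {z : ℤ // z = lsum q}) :
    (v : ℕ) → Option {z : ℤ // z = lsum v}
  | 0 => some ⟨0, by simp [lsum]⟩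
  | 1 => some ⟨1, by simp [lsum, show Ioc 0 1 = {1} by rfl, liouville_apply_one]⟩
  | v + 2 =>
    match blockSum look (v + 2) (v + 2) 1 0 with
    | none => none
    | some ⟨r, hr⟩ =>
      some ⟨(Nat.sqrt (v + 2) : ℤ) - r, by rw [hr, zero_add, lsum_eq_sqrt_sub (by omega)]⟩

/-- The small table `L(0), …, L(v + fuel)` as prefix sums of Mathlib's `liouville`
(tail-recursive; entry `i` sits at index `i`). [folklore] -/
def buildSmallAux : (fuel v : ℕ) → (z : ℤ) → z = lsum v → Array Entry → Array Entry
  | 0, _, _, _, arr => arr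
  | fuel + 1, v, z, hz, arr =>
    have hz' : z + liouville (v + 1) = lsum (v + 1) := by rw [lsum_succ, hz]
    buildSmallAux fuel (v + 1) (z + liouville (v + 1)) hz' (arr.push ⟨v + 1, _, hz'⟩)

/-- The small table `L(0), …, L(B)`. [folklore] -/
def buildSmall (B : ℕ) : Array Entry :=
  buildSmallAux B 0 0 (by simp [lsum]) #[Entry.zero]

/-- The large table: entry `i < K` holds `L(⌊N/(K-i)⌋)`, computed in increasing order of the
argument by `stepL` (a failed step stores the placeholder). [folklore] -/
def buildLarge (N B K : ℕ) (small : Array Entry) : Array Entry :=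
  (List.range K).foldl
    (fun arr i =>
      match stepL (lookup N B K small arr) (N / (K - i)) with
      | some ⟨z, hz⟩ => arr.push ⟨N / (K - i), z, hz⟩
      | none => arr.push Entry.zero)
    #[]

/-- Certified evaluation of `L(N)` with small-table bound `B` (any `B` is sound; `B ≈ N^{1/2}`
to `N^{2/3}` is fast). [folklore] -/
def certL (N B : ℕ) : Option {z : ℤ // z = lsum N} :=
  let small := buildSmall B
  let K := N / (B + 1)
  stepL (lookup N B K small (buildLarge N B K small)) N

/-- `certEq N B z = true` iff the certified evaluation of `L(N)` succeeded with value `z`. [folklore] -/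
def certEq (N B : ℕ) (z : ℤ) : Bool :=
  match certL N B with
  | some ⟨z', _⟩ => decide (z' = z)
  | none => false

/-- Soundness of the checker: `certEq N B z = true → L(N) = z` (no hypothesis on `B` or on the
tables). [folklore] -/
theorem lsum_eq_of_certEq {N B : ℕ} {z : ℤ} (h : certEq N B z = true) : lsum N = z := by
  unfold certEq at h
  split at h
  · next z' hz' _ => rw [← hz']; exact of_decide_eq_true h
  · exact absurd h Bool.false_ne_true

/-- **Tanaka 1980** (`ℕ` form): `L(906 150 257) = 1`, the certified evaluation
`certEq 906150257 100000 1` run by `native_decide` (axiom `Lean.ofReduceBool`; see the module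
docstring). R. S. Lehman (1960) had found `L(906 180 359) = 1`; Tanaka showed `906 150 257` is the
least `x ≥ 2` with `L(x) > 0`. [cite: Tanaka1980, main result] -/
theorem lsum_tanakaWitness : lsum 906150257 = 1 :=
  lsum_eq_of_certEq (B := 100000) (by native_decide)

end PolyaCounterexample

open PolyaCounterexample in
/-- **Tanaka 1980**: `L(906 150 257) = ∑_{n ≤ 906150257} λ(n) = 1`; in particular Pólya's
inequality `L(x) ≤ 0` fails at `x = 906 150 257`. [cite: Tanaka1980, main result] -/
theorem liouvilleSum_tanakaWitness : liouvilleSum 906150257 = 1 := by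
  rw [show (906150257 : ℝ) = ((906150257 : ℕ) : ℝ) by norm_num, liouvilleSum_natCast,
    lsum_tanakaWitness]

/-- **Discharge** of `Literature.NumberTheory.LFunctions.not_polya_conjecture` (Haselgrove 1958: Pólya's conjecture
`L(x) ≤ 0` for all `x ≥ 2` is false, "We are thus led to the conclusion that Pólya's conjecture
is false", p. 143). Haselgrove's own argument (`A*_T(831.847) > 0` with `T = 1000`) is not
constructive in `x`; the witness used here is Tanaka's `L(906 150 257) = 1`
(`liouvilleSum_tanakaWitness`, a `native_decide` evaluation, axiom `Lean.ofReduceBool`).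
[cite: HaselgroveMathematika1958, p. 143] -/
theorem not_polya_conjecture_holds : not_polya_conjecture := fun h =>
  absurd (h 906150257 (by norm_num)) (by rw [liouvilleSum_tanakaWitness]; norm_num)


/-! ### The smallest counterexample (Tanaka 1980): discharge of `polya_conjecture_first_failure` -/

/-- **Discharge** of `Literature.NumberTheory.LFunctions.polya_conjecture_first_failure` (**rh.S23**; Tanaka, *Tokyo J. Math.*
**3** (1980), p. 187: up to `10⁴`, `L(x) > 0` only for `x = 1`; `10001 ≤ x ≤ 906150000`: always
`L(x) < 0`; the first `x` with `L(x) > 0` beyond is `906150257`; p. 188: "`L(x) < 0` from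
`x = 587` to `x = 906150255`"): `0 < L(906150257)` and `L(n) ≤ 0` for all `2 ≤ n < 906150257`.
The printed proof is a machine computation of `L(x)`, `x ≤ 10⁹`; the proof here is the certified
segmented sieve of `LiouvilleSieve.lean`, evaluated in 25 compiled blocks
(`LiouvilleSieve/Chunk*.lean`, one `native_decide` each — their auxiliary axioms, i.e. trust in
the Lean compiler, are the only non-standard axioms of this theorem; proposal flag
`computational`) and chained in `LiouvilleSieve/Final.lean` (`LiouvilleSieve.Lsum_final`);
`LiouvilleSieve.Lsum` is definitionally `PolyaCounterexample.lsum`.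
[cite: Tanaka1980, pp. 187–188] -/
theorem polya_conjecture_first_failure_holds : polya_conjecture_first_failure := by
  refine ⟨by rw [liouvilleSum_tanakaWitness]; exact one_pos, fun n h2 hn => ?_⟩
  rw [liouvilleSum_natCast]
  exact LiouvilleSieve.Lsum_final.2 n h2 hn

end Literature.NumberTheory.LFunctions
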